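import Summits.Schanuel.Schanuel.Theorems.SoloInformedAE32Eventually

/-!
# Theorem AE₃♯-2 (η = 0): the explicit hypotheses of `soloCA_gelfond_input` hold eventually

Soloist file (informed mode, seat `solo-Schanuel-informed`, s184).  Pure real-analysis
bookkeeping for the seat's THEOREM AE₃♯-2 (`work/s184/CLUSTER-note.md` §6–§7), the full-depth
(cluster-weighted) form of THEOREM AE₃-2: with the SAME parameter shapes as in
`SoloInformedAE32Eventually` — `x = n^μ`, `K = ⌊n^{σ-μ}⌋`, `t = ⌊n^τ/2⌋ + 1`,
`N = ⌊n^{1-μ+δ}⌋`, `Lg = n^{β-μ+δ}`, `V = n^ν/4` — the hypotheses of `soloCA_gelfond_input`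
that differ from the AE₃-2 ones hold for all large `n`:

* `soloCE_W_compare`: `10 n^{ν'} ≤ n^ν` for `ν' < ν`, in the two shapes used below (the new
  radius `W = V K/(1600000 N)` is the AE₃-2 one divided by `10`, so the AE₃-2 lemmas are simply
  invoked at a slightly smaller exponent `ν'`);
* `soloCE_cond4` (`h₄`): `log 4 ≤ V K/(3200000 N)` when `0 < ν + σ - 1 - δ`;
* `soloCE_condD` (`h₅`, the budget of the 3-AP rigidity theorem at the root-count scale, now
  priced on `Q̃` and BLIND to `t`) — the ONE place where the threshold is used, as
  `2 + β - 3μ + 3δ < 2σ - 2μ + ν`, i.e. `ν > 2 + β - 2σ - μ + 3δ`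
  (AE₃-2 needed `ν > 3 + β - 3σ - 3τ - μ + 4δ` here);
* `soloCE_condE` (`h₆`) and `soloCE_condH` (the comparison with Gel'fond's lower bound): from
  `soloAW_condE`, `soloAW_condH` at a smaller exponent.

Balancing `soloCE_condD` against the transfer condition `1 + β + μ < σ + τ + ν` (`soloAW_condB`)
at `μ = (1 - σ + τ)/2` gives the AE₃♯-2 threshold `ν > β + (3 - 3σ - τ)/2` on `1 + τ < 3σ`
(next file).

What this is NOT.  Elementary inequalities only; nothing here bears on
`Literature.Periods.SchanuelConjecture` (the seat's verdict, no path, is unchanged).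
Tree files and Mathlib only; no definitions; axioms the standard three.
-/

namespace Summit.Schanuel.Schanuel.Theorems

open Filter

/-- `10 n^{ν'} ≤ n^ν` eventually (`ν' < ν`), in the two shapes used below: for the radius
(`(n^{ν'}/4) K/(160000 N)/2 ≤ (n^ν/4) K/(1600000 N)/2`) and for `h₄`
(`(n^{ν'}/4) K/(320000 N) ≤ (n^ν/4) K/(3200000 N)`). -/
theorem soloCE_W_compare (σ μ δ : ℝ) {ν ν' : ℝ} (h : ν' < ν) :
    ∀ᶠ n : ℕ in atTop,
      (n : ℝ) ^ ν' / 4 * ⌊(n : ℝ) ^ (σ - μ)⌋₊ / (160000 * ⌊(n : ℝ) ^ (1 - μ + δ)⌋₊) / 2 ≤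
          (n : ℝ) ^ ν / 4 * ⌊(n : ℝ) ^ (σ - μ)⌋₊ / (1600000 * ⌊(n : ℝ) ^ (1 - μ + δ)⌋₊) / 2 ∧
        (n : ℝ) ^ ν' / 4 * ⌊(n : ℝ) ^ (σ - μ)⌋₊ / (320000 * ⌊(n : ℝ) ^ (1 - μ + δ)⌋₊) ≤
          (n : ℝ) ^ ν / 4 * ⌊(n : ℝ) ^ (σ - μ)⌋₊ / (3200000 * ⌊(n : ℝ) ^ (1 - μ + δ)⌋₊) := by
  filter_upwards [eventually_ge_atTop 1, eventually_const_mul_rpow_le_rpow h 10] with n hn hc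
  have hK0 : (0 : ℝ) ≤ ⌊(n : ℝ) ^ (σ - μ)⌋₊ := Nat.cast_nonneg _
  have base : 10 * ((n : ℝ) ^ ν' * ⌊(n : ℝ) ^ (σ - μ)⌋₊) ≤
      (n : ℝ) ^ ν * ⌊(n : ℝ) ^ (σ - μ)⌋₊ := by
    rw [← mul_assoc]
    exact mul_le_mul_of_nonneg_right hc hK0
  have h2 : (n : ℝ) ^ ν / 4 * ⌊(n : ℝ) ^ (σ - μ)⌋₊ / (1600000 * ⌊(n : ℝ) ^ (1 - μ + δ)⌋₊) / 2 =
      (n : ℝ) ^ ν * ⌊(n : ℝ) ^ (σ - μ)⌋₊ / (12800000 * ⌊(n : ℝ) ^ (1 - μ + δ)⌋₊) := by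
    field_simp
    ring
  have h2' : (n : ℝ) ^ ν / 4 * ⌊(n : ℝ) ^ (σ - μ)⌋₊ / (3200000 * ⌊(n : ℝ) ^ (1 - μ + δ)⌋₊) =
      (n : ℝ) ^ ν * ⌊(n : ℝ) ^ (σ - μ)⌋₊ / (12800000 * ⌊(n : ℝ) ^ (1 - μ + δ)⌋₊) := by
    field_simp
    ring
  have h1 : (n : ℝ) ^ ν' / 4 * ⌊(n : ℝ) ^ (σ - μ)⌋₊ / (160000 * ⌊(n : ℝ) ^ (1 - μ + δ)⌋₊) / 2 =
      10 * ((n : ℝ) ^ ν' * ⌊(n : ℝ) ^ (σ - μ)⌋₊) / (12800000 * ⌊(n : ℝ) ^ (1 - μ + δ)⌋₊) := by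
    field_simp
    ring
  have h1' : (n : ℝ) ^ ν' / 4 * ⌊(n : ℝ) ^ (σ - μ)⌋₊ / (320000 * ⌊(n : ℝ) ^ (1 - μ + δ)⌋₊) =
      10 * ((n : ℝ) ^ ν' * ⌊(n : ℝ) ^ (σ - μ)⌋₊) / (12800000 * ⌊(n : ℝ) ^ (1 - μ + δ)⌋₊) := by
    field_simp
    ring
  have key : 10 * ((n : ℝ) ^ ν' * ⌊(n : ℝ) ^ (σ - μ)⌋₊) / (12800000 * ⌊(n : ℝ) ^ (1 - μ + δ)⌋₊) ≤
      (n : ℝ) ^ ν * ⌊(n : ℝ) ^ (σ - μ)⌋₊ / (12800000 * ⌊(n : ℝ) ^ (1 - μ + δ)⌋₊) :=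
    div_le_div_of_nonneg_right base (by positivity)
  constructor
  · rw [h1, h2]; exact key
  · rw [h1', h2']; exact key

/-- Hypothesis `h₄` of `soloCA_gelfond_input`: eventually `log 4 ≤ V K/(3200000 N)`,
`V = n^ν/4` (`0 < ν + σ - 1 - δ`). -/
theorem soloCE_cond4 {σ ν μ δ : ℝ} (hμσ : μ < σ) (ha0 : 0 < 1 - μ + δ)
    (hg : 0 < ν + σ - 1 - δ) :
    ∀ᶠ n : ℕ in atTop, Real.log 4 ≤
      (n : ℝ) ^ ν / 4 * ⌊(n : ℝ) ^ (σ - μ)⌋₊ / (3200000 * ⌊(n : ℝ) ^ (1 - μ + δ)⌋₊) := by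
  set θ : ℝ := (ν + σ - 1 - δ) / 2 with hθ
  have hlt : ν - θ < ν := by rw [hθ]; linarith
  have hg' : 0 < ν - θ + σ - 1 - δ := by rw [hθ]; linarith
  filter_upwards [soloAW_cond4 (ν := ν - θ) hμσ ha0 hg', soloCE_W_compare σ μ δ hlt]
    with n h ⟨_w1, hb⟩
  exact h.trans hb

/-- Hypothesis `h₅` of `soloCA_gelfond_input` (the budget of the 3-AP rigidity theorem at the
root-count scale, priced on `Q̃`, blind to `t`), eventually — the one place where
`ν > 2 + β - 2σ - μ + 3δ` is used (as `2 + β - 3μ + 3δ < 2σ - 2μ + ν`). -/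
theorem soloCE_condD {β σ ν μ δ : ℝ} (hβ : 1 ≤ β) (hμσ : μ < σ) (ha0 : 0 < 1 - μ + δ)
    (hν : 2 + β - 3 * μ + 3 * δ < 2 * σ - 2 * μ + ν) :
    ∀ᶠ n : ℕ in atTop,
      900000 * (3 * (⌊(n : ℝ) ^ (1 - μ + δ)⌋₊ : ℝ) ^ 2 *
          ((⌊(n : ℝ) ^ (1 - μ + δ)⌋₊ : ℝ) / 2 + (n : ℝ) ^ (β - μ + δ)) +
        2 * (⌊(n : ℝ) ^ (1 - μ + δ)⌋₊ : ℝ) ^ 3) ≤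
      (⌊(n : ℝ) ^ (σ - μ)⌋₊ : ℝ) ^ 2 * ((n : ℝ) ^ ν / 4) := by
  filter_upwards [soloT1_floor (sub_pos.mpr hμσ), soloT1_floor ha0,
    eventually_const_mul_rpow_le_rpow hν (900000 * 7 * 16)]
    with n ⟨hn1, _w2, _w3, hKge⟩ ⟨_w4, _w5, hNle, _w6⟩ hc
  have hn0 : (0 : ℝ) < n := by linarith
  set K : ℝ := (⌊(n : ℝ) ^ (σ - μ)⌋₊ : ℝ) with hKdef
  set N : ℝ := (⌊(n : ℝ) ^ (1 - μ + δ)⌋₊ : ℝ) with hNdef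
  have hN0 : 0 ≤ N := by rw [hNdef]; exact Nat.cast_nonneg _
  have hab : (n : ℝ) ^ (1 - μ + δ) ≤ (n : ℝ) ^ (β - μ + δ) :=
    Real.rpow_le_rpow_of_exponent_le hn1 (by linarith)
  have hNβ : N ≤ (n : ℝ) ^ (β - μ + δ) := hNle.trans hab
  have hp1 : 0 ≤ (n : ℝ) ^ (1 - μ + δ) := by positivity
  have hp2 : 0 ≤ (n : ℝ) ^ (β - μ + δ) := by positivity
  -- the left side is at most `900000 · 7 · n^{2+β-3μ+3δ}`
  have e1 : ((n : ℝ) ^ (1 - μ + δ)) ^ 2 * (n : ℝ) ^ (β - μ + δ) =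
      (n : ℝ) ^ (2 + β - 3 * μ + 3 * δ) := by
    rw [soloTT_rpow_pow hn0.le, ← Real.rpow_add hn0]
    congr 1
    push_cast
    ring
  have e2 : ((n : ℝ) ^ (1 - μ + δ)) ^ 3 ≤ (n : ℝ) ^ (2 + β - 3 * μ + 3 * δ) := by
    rw [soloTT_rpow_pow hn0.le]
    exact Real.rpow_le_rpow_of_exponent_le hn1 (by push_cast; linarith)
  have hN2 : N ^ 2 ≤ ((n : ℝ) ^ (1 - μ + δ)) ^ 2 := pow_le_pow_left₀ hN0 hNle 2
  have hN3 : N ^ 3 ≤ ((n : ℝ) ^ (1 - μ + δ)) ^ 3 := pow_le_pow_left₀ hN0 hNle 3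
  have hy : N / 2 + (n : ℝ) ^ (β - μ + δ) ≤ 3 / 2 * (n : ℝ) ^ (β - μ + δ) := by linarith
  have hL : 900000 * (3 * N ^ 2 * (N / 2 + (n : ℝ) ^ (β - μ + δ)) + 2 * N ^ 3) ≤
      900000 * 7 * (n : ℝ) ^ (2 + β - 3 * μ + 3 * δ) := by
    have h1 : N ^ 2 * (N / 2 + (n : ℝ) ^ (β - μ + δ)) ≤
        ((n : ℝ) ^ (1 - μ + δ)) ^ 2 * (3 / 2 * (n : ℝ) ^ (β - μ + δ)) :=
      mul_le_mul hN2 hy (by positivity) (by positivity)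
    have h1' : ((n : ℝ) ^ (1 - μ + δ)) ^ 2 * (3 / 2 * (n : ℝ) ^ (β - μ + δ)) =
        3 / 2 * (n : ℝ) ^ (2 + β - 3 * μ + 3 * δ) := by rw [← e1]; ring
    have hpos : 0 ≤ (n : ℝ) ^ (2 + β - 3 * μ + 3 * δ) := by positivity
    nlinarith [h1, h1', hN3, e2]
  -- the right side is at least `n^{2σ-2μ+ν} / 16`
  have hR : (n : ℝ) ^ (2 * σ - 2 * μ + ν) / 16 ≤ K ^ 2 * ((n : ℝ) ^ ν / 4) := by
    have hK2 : ((n : ℝ) ^ (σ - μ) / 2) ^ 2 ≤ K ^ 2 := pow_le_pow_left₀ (by positivity) hKge 2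
    have e3 : (n : ℝ) ^ (2 * σ - 2 * μ + ν) = ((n : ℝ) ^ (σ - μ)) ^ 2 * (n : ℝ) ^ ν := by
      rw [soloTT_rpow_pow hn0.le, ← Real.rpow_add hn0]
      congr 1
      push_cast
      ring
    rw [e3]
    have hν0 : 0 ≤ (n : ℝ) ^ ν / 4 := by positivity
    calc ((n : ℝ) ^ (σ - μ)) ^ 2 * (n : ℝ) ^ ν / 16
        = ((n : ℝ) ^ (σ - μ) / 2) ^ 2 * ((n : ℝ) ^ ν / 4) := by ring
      _ ≤ K ^ 2 * ((n : ℝ) ^ ν / 4) := mul_le_mul_of_nonneg_right hK2 hν0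
  linarith [hc]

/-- Hypothesis `h₆` of `soloCA_gelfond_input` (the dilation losses), eventually, when
`1 - τ + δ - μ < ν + σ - 1 - δ` and `β - σ - τ + δ < ν + σ - 1 - δ`. -/
theorem soloCE_condE (ξ : ℂ) {β σ τ ν μ δ : ℝ} (hβ : 1 ≤ β) (hμσ : μ < σ) (hτ0 : 0 ≤ τ)
    (ha0 : 0 < 1 - μ + δ) (hm1 : 1 - τ + δ - μ < ν + σ - 1 - δ)
    (hm2 : β - σ - τ + δ < ν + σ - 1 - δ) :
    ∀ᶠ n : ℕ in atTop,
      20 * ((⌊(n : ℝ) ^ (1 - μ + δ)⌋₊ : ℝ) / ((⌊(n : ℝ) ^ τ / 2⌋₊ + 1 : ℕ) : ℝ)) /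
            ⌊(n : ℝ) ^ (σ - μ)⌋₊ * Real.log (⌊(n : ℝ) ^ (σ - μ)⌋₊ * ‖ξ‖ + 1) +
        20 * ((((⌊(n : ℝ) ^ (1 - μ + δ)⌋₊ : ℝ) / 2 + (n : ℝ) ^ (β - μ + δ)) /
            ((⌊(n : ℝ) ^ τ / 2⌋₊ + 1 : ℕ) : ℝ))) / ⌊(n : ℝ) ^ (σ - μ)⌋₊ ≤
      (n : ℝ) ^ ν / 4 * ⌊(n : ℝ) ^ (σ - μ)⌋₊ / (1600000 * ⌊(n : ℝ) ^ (1 - μ + δ)⌋₊) / 2 := by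
  set θ : ℝ := min (ν + σ - 1 - δ - (1 - τ + δ - μ)) (ν + σ - 1 - δ - (β - σ - τ + δ)) / 2
    with hθ
  have hθ0 : 0 < θ := by
    rw [hθ]; exact half_pos (lt_min (by linarith) (by linarith))
  have hθ1 : θ < ν + σ - 1 - δ - (1 - τ + δ - μ) := by
    have := min_le_left (ν + σ - 1 - δ - (1 - τ + δ - μ)) (ν + σ - 1 - δ - (β - σ - τ + δ))
    rw [hθ]; linarith
  have hθ2 : θ < ν + σ - 1 - δ - (β - σ - τ + δ) := by
    have := min_le_right (ν + σ - 1 - δ - (1 - τ + δ - μ)) (ν + σ - 1 - δ - (β - σ - τ + δ))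
    rw [hθ]; linarith
  have hlt : ν - θ < ν := by linarith
  filter_upwards [soloAW_condE ξ hβ hμσ hτ0 ha0 (ν := ν - θ) (by linarith) (by linarith),
    soloCE_W_compare σ μ δ hlt] with n h ⟨hb, _w7⟩
  exact h.trans hb

/-- The comparison with Gel'fond's lower bound: eventually
`40 a (n+1)^{e₁} (n+1)^{e₂} < (n^ν/4) K/(1600000 N)/2` when `e₁ + e₂ < ν + σ - 1 - δ`. -/
theorem soloCE_condH {σ ν μ δ e₁ e₂ : ℝ} (hμσ : μ < σ) (ha0 : 0 < 1 - μ + δ) (he₁ : 0 ≤ e₁)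
    (he₂ : 0 ≤ e₂) (hE : e₁ + e₂ < ν + σ - 1 - δ) {a : ℝ} (ha : 0 < a) :
    ∀ᶠ n : ℕ in atTop, 40 * a * ((n : ℝ) + 1) ^ e₁ * ((n : ℝ) + 1) ^ e₂ <
      (n : ℝ) ^ ν / 4 * ⌊(n : ℝ) ^ (σ - μ)⌋₊ / (1600000 * ⌊(n : ℝ) ^ (1 - μ + δ)⌋₊) / 2 := by
  set θ : ℝ := (ν + σ - 1 - δ - (e₁ + e₂)) / 2 with hθ
  have hlt : ν - θ < ν := by rw [hθ]; linarith
  have hE' : e₁ + e₂ < ν - θ + σ - 1 - δ := by rw [hθ]; linarith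
  filter_upwards [soloAW_condH (ν := ν - θ) hμσ ha0 he₁ he₂ hE' ha,
    soloCE_W_compare σ μ δ hlt] with n h ⟨hb, _w8⟩
  exact lt_of_lt_of_le h hb

end Summit.Schanuel.Schanuel.Theorems
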